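import Summits.QuantumFields.YangMills.Theorems.BalabanUVNodesN15KingModelTheorem21Rate
import Summits.QuantumFields.YangMills.Theorems.BalabanUVNodesN15KingModelContinuumKernelDecay
import Literature.MathematicalPhysics.QuantumFieldTheory.Balaban1983to89.Beta.WoodburyFibre

/-!
# BalabanUVNodes ∕ N15 — THE KING-MODEL RUNG (PART Ϝ-d): THE BLOCK-SMEARED TWO-POINT SCHWINGER FUNCTION OF THE FREE FIELD —
# `S₂^{(K)}(b, b′) = E_{ε_K}[(Qψ)(b)(Qψ)(b′)] = N^d(QB⁻¹Qᵀ)(b, b′) → S₂^{(∞)}(b, b′) = |Ω|⁻¹Σ_q S_∞(p′(q))Re e^{iq·(b′−b)}` WITH (4.38)'s RATE, `|S₂^{(∞)}| ≤ m⁻²`, DECAY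
# (Track A, DAG node N15 = NE2; FAN-OUT v1.1 §N15 s3 «KING-MODEL RUNG … NE2's analogue DECIDED in the model»)

HONEST FRAMING.  Count-neutral (cell `pub-ymgap`, seat `pub-ymgap-dag-n15-e` g33; `--supports stmt-QuantumFields-27366 --as helper` = K3⁸
`SpineGivenEndpointR13SepCoPHV`).  TEMPLATE LITERATURE: C. King, *The U(1) Higgs model. I. The continuum limit*, Commun. Math. Phys. **102** (1986) 649–677
[King1986] — KING's OWN `A = 0`, `g = 0` MODEL (free massive lattice scalar field) on the fine tori `Tor (fine N M)` over every unit torus `Ω = Tor M` and on the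
tori (2.21).  NOT the U(1) Higgs model's Schwinger functions; NOT Bałaban's objects; NOT a node discharge (N15 is booked through n15-a's knit, untouched here);
nothing continuum-Yang–Mills ∕ ℝ⁴ ∕ OS ∕ mass-gap ∕ Clay.  0 `sorry`; standard axioms; THREE definitions (`kingS2`, `kingS2Lim`, `kingFreeS2` — the objects).

THE MATHEMATICS.  The free fine field has covariance `P_η⁻¹ = N^dB⁻¹` (part Ϝ-a), so the two-point function of its unit-block means — the Schwinger two-point
function smeared against the block indicators `1_{B(b)}, 1_{B(b′)}` with King's Riemann weights — is `S₂^{(K)}(b,b′) = (Q P_η⁻¹ Qᵀ)(b,b′) = N^d(QB⁻¹Qᵀ)(b,b′)`; it is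
the HESSIAN of the generating functional, `ln Z_η(Ω, J∘blk) = ½Σ_{b,b′} J(b)S₂^{(K)}(b,b′)J(b′)` (Ϝ-a's `log_kingFineZ_blockSrc_eq`), which is how it is introduced here
(no Gaussian moment formula is needed).  Part Ϡ-d's polarization gives the plane-wave form `S₂^{(K)}(b,b′) = |Ω|⁻¹Σ_q S_{L^K}(q)Re e^{iq·(b′−b)}`, part Ϛ's Woodbury form
gives `S₂^{(K)} = (Δ^{(K)})⁻¹ − a_K⁻¹·1` for EVERY `a > 0` (the block-field covariance minus the block-spin white noise), so: `S₂^{(K)} → S₂^{(∞)} := |Ω|⁻¹Σ_q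
S_∞(p′(q))Re e^{iq·(b′−b)} = C^{(∞)} − a_∞⁻¹·1` (Ϡ-c Tannery; `a`-FREE), with the (4.38)-SHAPE RATE `|S₂^{(K)} − S₂^{(∞)}| ≤ (2C_diff + a_∞⁻¹)e^{−(κ_M∕2)|b−b′|_T}L^{−K}`
(Ϡ-e's kernel rate + Ϝ-c's exact noise rate `L^{−2K}a_∞⁻¹` on the diagonal), the UNIFORM bound `|S₂^{(∞)}(b,b′)| ≤ m⁻²` (sharp ceiling `S_∞ ≤ m⁻²`, `|Re e^{iθ}| ≤ 1` —
VOLUME-FREE), Thm 3.3's exponential DECAY off the diagonal `|S₂^{(∞)}(b,b′)| ≤ (2∕γ_m)e^{−κ_M|b−b′|_T}` (`b ≠ b′`, part Ϡ-j), positivity as a form `0 ≤ Σ JS₂^{(∞)}J ≤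
m⁻²⟨J,J⟩`, symmetry and translation invariance.  On a torus (2.21) this is Theorem 2.1's statement for the two-point function: the limit exists on every torus with
a bound that does not even grow with `|T|`.

WHAT THIS FILE PROVES (kernel).  §1 (every unit torus `M : Fin d → ℕ`, every `N ≥ 1`): `kingS2`, `kingS2_symm`, ★ `log_kingFineZ_blockSrc_eq_sum₂` (Hessian identity),
★★ `kingS2_eq_fourier`, ★★ `kingS2_eq_blockCov_sub_noise` (`= (Δ^{(K)})⁻¹(b,b′) − a_K⁻¹[b=b′]`, every `a > 0`), `kingS2_form_eq` (`Σ JS₂J = N^d⟨J,QB⁻¹QᵀJ⟩`),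
`kingS2_form_nonneg`, `kingS2_form_le` (`≤ m⁻²⟨J,J⟩`), `abs_re_torusChar_le`, `abs_fourierKernel_le`, ★ `abs_kingS2_le` (`|S₂^{(K)}| ≤ m⁻²`).  §2 (`M : Fin (d+1) → ℕ`): `kingS2Lim` (`a`-free),
`kingS2Lim_eq_blockCovLim_sub` (every `a`), ★★ **`tendsto_kingS2`**, ★★★ **`abs_kingS2_sub_lim_le`** ((4.38) shape, rate `L^{−K}`), `kingS2Lim_symm`, `kingS2Lim_transl`,
★★ `abs_kingS2Lim_le` (`≤ m⁻²`, volume-free), ★★ **`abs_kingS2Lim_le_decay`** (off-diagonal Thm 3.3 decay), `kingS2Lim_form_eq`, ★ `kingS2Lim_form_nonneg`, `kingS2Lim_form_le`.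
§3 (tori (2.21)): `kingFreeS2`, ★★★ **`kingFreeS2_continuumLimit`** (limit + volume-free bound + rate on every `Torus221`).

HONEST SCOPE.  Free field; unit-block smearing only (point values of the continuum two-point function are not addressed — in `d + 1 ≥ 2` they diverge on the
diagonal); odd `L ≥ 3` de facto, `m² > 0`.  N15 untouched; counts unmoved.
Locators: [King1986] (2.4)–(2.6) p.652, (2.13)–(2.16) p.653, Thm 2.1 (2.22)–(2.23) p.654, Thm 3.3 (3.6) p.655, (4.5) p.670, (4.35) p.674, Lemma 4.5 (4.38) p.675.
-/

noncomputable section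

open scoped BigOperators ComplexConjugate
open Finset Matrix Filter Topology Complex

namespace Summit.QuantumFields.YangMills.BalabanUVNodes.N15KingModelRung

open Literature.MathematicalPhysics.QuantumFieldTheory.Balaban1983to89.B5Prop11Plancherel (Tor fine chi sOf conj_chi)
open Literature.MathematicalPhysics.QuantumFieldTheory.King1986 (aK aK_pos)
open Literature.MathematicalPhysics.QuantumFieldTheory.King1986.Torus
open Literature.MathematicalPhysics.QuantumFieldTheory.King1986.ContinuumLimit (eps eps_pos Torus221)

variable {d : ℕ}

/-! ## §1 The block-smeared two-point function at finite `η` -/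

section Finite

variable (N : ℕ) [NeZero N] (M : Fin d → ℕ) [hM : ∀ μ, NeZero (M μ)]

/-- **The block-smeared Schwinger two-point function of the free fine field**: `S₂(b,b′) = E_η[(Qψ)(b)(Qψ)(b′)] = N^d·(QB⁻¹Qᵀ)(b,b′)` (`QP_η⁻¹Qᵀ` with `P_η⁻¹ = N^dB⁻¹`).
[cite: King1986, (2.4)–(2.6) p.652, (2.13)–(2.14) p.653] -/
def kingS2 (m2 : ℝ) (b b' : Tor M) : ℝ :=
  (N : ℝ) ^ d * (Qmat N M * (lapF (fine N M) ((N : ℝ) ^ 2) m2)⁻¹ * (Qmat N M)ᵀ) b b'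

/-- `S₂` is symmetric. [cite: King1986, (2.14) p.653] -/
theorem kingS2_symm (m2 : ℝ) (b b' : Tor M) : kingS2 N M m2 b b' = kingS2 N M m2 b' b := by
  unfold kingS2
  congr 1
  have h := blockAvg_transpose N M ((N : ℝ) ^ 2) m2
  rw [← h, Matrix.transpose_apply, h]

/-- `Σ_{b,b′} J(b)S₂(b,b′)J(b′) = N^d⟨J, QB⁻¹QᵀJ⟩`. [folklore] -/
theorem kingS2_form_eq (m2 : ℝ) (J : Tor M → ℝ) :
    ∑ b, ∑ b', J b * kingS2 N M m2 b b' * J b'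
      = (N : ℝ) ^ d * (J ⬝ᵥ ((Qmat N M * (lapF (fine N M) ((N : ℝ) ^ 2) m2)⁻¹ * (Qmat N M)ᵀ) *ᵥ J)) := by
  simp only [kingS2, dotProduct, Matrix.mulVec, Finset.mul_sum]
  refine Finset.sum_congr rfl fun b _ => Finset.sum_congr rfl fun b' _ => ?_
  ring

/-- ★ **THE HESSIAN IDENTITY**: `ln Z_η(Ω, J∘blk) = ½Σ_{b,b′} J(b)S₂(b,b′)J(b′)` — the two-point function is the second coefficient of the generating functional.
[cite: King1986, (2.6) p.652, Thm 2.1 (2.22) p.654] -/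
theorem log_kingFineZ_blockSrc_eq_sum₂ {m2 : ℝ} (hm : 0 < m2) (J : Tor M → ℝ) :
    Real.log (kingFineZ N M m2 (blockSrc N M J)) = (1 / 2 : ℝ) * ∑ b, ∑ b', J b * kingS2 N M m2 b b' * J b' := by
  rw [log_kingFineZ_blockSrc_eq N M hm, kingS2_form_eq]

/-- ★★ **PLANE-WAVE FORM**: `S₂(b,b′) = |Ω|⁻¹Σ_q S_N(q)Re e^{iq·(b′−b)}` (part Ϡ-d's polarization). [cite: King1986, (4.5) p.670, (4.35) p.674] -/
theorem kingS2_eq_fourier {m2 : ℝ} (hm : 0 < m2) (b b' : Tor M) :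
    kingS2 N M m2 b b' = (Fintype.card (Tor M) : ℝ)⁻¹ * ∑ q : Tor M, Sfib N M ((N : ℝ) ^ 2) m2 q * (chi M q (b' - b)).re := by
  unfold kingS2
  exact blockAvg_apply_eq_fourier N M (by positivity) hm b b'

/-- ★★ **`S₂ = (Δ_eff)⁻¹ − a⁻¹·1` for EVERY `a > 0`** — the block-field covariance minus the block-spin white noise (part Ϛ's Woodbury form of (2.14)).
[cite: King1986, (2.13)–(2.14) p.653] -/
theorem kingS2_eq_effLaplacian_inv_sub (hN1 : 1 ≤ N) {a m2 : ℝ} (ha : 0 < a) (hm : 0 < m2) (b b' : Tor M) :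
    kingS2 N M m2 b b' = (effLaplacian N M a ((N : ℝ) ^ 2) m2)⁻¹ b b' - a⁻¹ * (if b = b' then 1 else 0) := by
  rw [effLaplacian_inv_eq_noise_add_blockAvg N M hN1 ha hm, Matrix.add_apply, Matrix.smul_apply, Matrix.one_apply, Matrix.smul_apply, smul_eq_mul,
    smul_eq_mul, kingS2]
  ring

/-- `0 ≤ Σ JS₂J` (a covariance). [cite: King1986, (2.14) p.653] -/
theorem kingS2_form_nonneg {m2 : ℝ} (hm : 0 < m2) (J : Tor M → ℝ) : 0 ≤ ∑ b, ∑ b', J b * kingS2 N M m2 b b' * J b' := by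
  rw [kingS2_form_eq, blockAvg_form N M (by positivity) hm J]
  exact fourierSum_Sfib_nonneg N M hm J

/-- `Σ JS₂J ≤ m⁻²⟨J, J⟩`. [cite: King1986, (2.14) p.653, (4.8) p.671] -/
theorem kingS2_form_le {m2 : ℝ} (hm : 0 < m2) (J : Tor M → ℝ) : ∑ b, ∑ b', J b * kingS2 N M m2 b b' * J b' ≤ m2⁻¹ * (J ⬝ᵥ J) := by
  rw [kingS2_form_eq, blockAvg_form N M (by positivity) hm J]
  exact fourierSum_Sfib_le N M hm J

omit hM in
/-- `|Re e^{iq·x}| ≤ 1`. [folklore] -/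
theorem abs_re_torusChar_le (M : Fin d → ℕ) [∀ μ, NeZero (M μ)] (p x : Tor M) : |(chi M p x).re| ≤ 1 := by
  rw [← Literature.MathematicalPhysics.QuantumFieldTheory.Balaban1983to89.Beta.WoodburyFibre.norm_chi M p x]
  exact Complex.abs_re_le_norm _

/-- A plane-wave sum with weights in `[0, m⁻²]` is at most `m⁻²` in absolute value. [folklore] -/
theorem abs_fourierKernel_le {w : Tor M → ℝ} {B : ℝ} (hw0 : ∀ q, 0 ≤ w q) (hwB : ∀ q, w q ≤ B) (x : Tor M) :
    |(Fintype.card (Tor M) : ℝ)⁻¹ * ∑ q : Tor M, w q * (chi M q x).re| ≤ B := by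
  have hcard : (0 : ℝ) < Fintype.card (Tor M) := by exact_mod_cast Fintype.card_pos
  rw [abs_mul, abs_of_pos (inv_pos.mpr hcard), inv_mul_le_iff₀ hcard]
  calc |∑ q : Tor M, w q * (chi M q x).re| ≤ ∑ q : Tor M, |w q * (chi M q x).re| := Finset.abs_sum_le_sum_abs _ _
    _ ≤ ∑ _q : Tor M, B := Finset.sum_le_sum fun q _ => by
        rw [abs_mul, abs_of_nonneg (hw0 q)]
        calc w q * |(chi M q x).re| ≤ w q * 1 := mul_le_mul_of_nonneg_left (abs_re_torusChar_le M q x) (hw0 q)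
          _ ≤ B := by rw [mul_one]; exact hwB q
    _ = Fintype.card (Tor M) * B := by rw [Finset.sum_const, Finset.card_univ, nsmul_eq_mul]

/-- ★ `|S₂(b,b′)| ≤ m⁻²`, uniformly in `η`, the torus and the sites. [cite: King1986, (2.14) p.653, (4.8) p.671] -/
theorem abs_kingS2_le {m2 : ℝ} (hm : 0 < m2) (b b' : Tor M) : |kingS2 N M m2 b b'| ≤ m2⁻¹ := by
  rw [kingS2_eq_fourier N M hm]
  exact abs_fourierKernel_le M (fun q => Sfib_nonneg (by positivity) hm q) (fun q => Sfib_le_inv_mass N M (by positivity) hm q) _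

end Finite

/-! ## §2 The limit `S₂^{(∞)}`, the (4.38)-shape rate, decay and positivity -/

section Limit

variable (L : ℕ) (M : Fin (d + 1) → ℕ) [hM : ∀ μ, NeZero (M μ)]

/-- **The continuum block-smeared two-point function** `S₂^{(∞)}(b,b′) = |Ω|⁻¹Σ_q S_∞(p′(q))Re e^{iq·(b′−b)}` — `a`-free; `= C^{(∞)} − a_∞⁻¹·1` for every `a`.
[cite: King1986, Thm 2.1 (2.22) p.654, (4.5) p.670, (2.14) p.653] -/
def kingS2Lim (m2 : ℝ) (b b' : Tor M) : ℝ :=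
  (Fintype.card (Tor M) : ℝ)⁻¹ * ∑ q : Tor M, aliasSeries0 m2 (sOf M q) * (chi M q (b' - b)).re

/-- `S₂^{(∞)} = C^{(∞)} − a_∞⁻¹·1` (part Ϡ-e's `blockCovLim`, every `a`). [cite: King1986, (2.14) p.653] -/
theorem kingS2Lim_eq_blockCovLim_sub (a m2 : ℝ) (b b' : Tor M) :
    kingS2Lim M m2 b b' = blockCovLim L M a m2 b b' - (aInf a L)⁻¹ * (if b = b' then 1 else 0) := by
  unfold kingS2Lim blockCovLim
  ring

/-- ★★ **THE LIMIT**: `S₂^{(K)}(b,b′) → S₂^{(∞)}(b,b′)` (odd `L ≥ 2`, `m² > 0`, every unit torus, every `b, b′`). [cite: King1986, Thm 2.1 (2.22) p.654, (4.5) p.670] -/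
theorem tendsto_kingS2 (hLodd : Odd L) (hL : 2 ≤ L) {m2 : ℝ} (hm : 0 < m2) (b b' : Tor M) :
    haveI : NeZero L := ⟨by omega⟩
    Tendsto (fun K : ℕ => kingS2 (L ^ K) M m2 b b') atTop (𝓝 (kingS2Lim M m2 b b')) := by
  haveI : NeZero L := ⟨by omega⟩
  have hfun : (fun K : ℕ => kingS2 (L ^ K) M m2 b b')
      = fun K : ℕ => (Fintype.card (Tor M) : ℝ)⁻¹ * ∑ q : Tor M, Sfib (L ^ K) M (((L ^ K : ℕ) : ℝ) ^ 2) m2 q * (chi M q (b' - b)).re :=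
    funext fun K => kingS2_eq_fourier (L ^ K) M hm b b'
  rw [hfun]
  unfold kingS2Lim
  exact tendsto_const_nhds.mul (tendsto_finsetSum _ fun q _ => (tendsto_Sfib_pow L M hLodd hL hm q).mul_const _)

/-- ★★★ **THE (4.38)-SHAPE RATE FOR THE TWO-POINT FUNCTION**: for odd `L ≥ 2`, `a, m² > 0`, `K ≥ 1`,
`|S₂^{(K)}(b,b′) − S₂^{(∞)}(b,b′)| ≤ (2C_diff + a_∞⁻¹)·e^{−(κ_M∕2)|b−b′|_T}·L^{−K}` (every auxiliary `a > 0` — the constants are part Ϡ-e's).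
[cite: King1986, Lemma 4.5 (4.38) p.675, Thm 2.1 (2.22) p.654] -/
theorem abs_kingS2_sub_lim_le (hLodd : Odd L) (hL : 2 ≤ L) {a m2 : ℝ} (ha : 0 < a) (hm : 0 < m2) {K : ℕ} (hK : 1 ≤ K) (b b' : Tor M) :
    haveI : NeZero L := ⟨by omega⟩
    |kingS2 (L ^ K) M m2 b b' - kingS2Lim M m2 b b'|
      ≤ (2 * CdiffM (d + 1) a m2 L + (aInf a L)⁻¹) * Real.exp (-(kapM (d + 1) a m2 L / 2 * tdistT M b b')) * ((L : ℝ) ^ K)⁻¹ := by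
  haveI : NeZero L := ⟨by omega⟩
  have hL1 : (1 : ℝ) < L := by exact_mod_cast (show 1 < L by omega)
  have hLK : 1 ≤ L ^ K := Nat.one_le_pow K L (by omega)
  have haK := aK_pos ha hL1 hK
  have haI := aInf_pos ha hL1
  have hkern := abs_blockCov_sub_lim_le L M hLodd hL ha hm hK b b'
  have hE : 0 < Real.exp (-(kapM (d + 1) a m2 L / 2 * tdistT M b b')) := Real.exp_pos _
  have hC : 0 ≤ CdiffM (d + 1) a m2 L := CdiffM_nonneg (d := d + 1) ha hm hL
  -- the decomposition `S₂^{(K)} − S₂^{(∞)} = (blockCov − C^{(∞)}) − (a_K⁻¹ − a_∞⁻¹)[b = b′]`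
  have hdec : kingS2 (L ^ K) M m2 b b' - kingS2Lim M m2 b b'
      = (blockCov L (L ^ K) M a m2 K b b' - blockCovLim L M a m2 b b') - ((aK a L K)⁻¹ - (aInf a L)⁻¹) * (if b = b' then 1 else 0) := by
    rw [kingS2_eq_effLaplacian_inv_sub (L ^ K) M hLK haK hm, kingS2Lim_eq_blockCovLim_sub L M a m2, blockCov]
    ring
  rw [hdec]
  have hpowle : ((L : ℝ) ^ (2 * K))⁻¹ ≤ ((L : ℝ) ^ K)⁻¹ := by
    refine inv_anti₀ (by positivity) (pow_le_pow_right₀ hL1.le (by omega))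
  refine (abs_sub _ _).trans ?_
  rw [add_mul, add_mul]
  refine add_le_add hkern ?_
  rw [abs_mul, abs_inv_aK_sub_inv_aInf L ha hL K]
  by_cases hbb : b = b'
  · subst hbb
    rw [if_pos rfl, abs_one, mul_one, tdistT_self, mul_zero, neg_zero, Real.exp_zero, mul_one]
    calc ((L : ℝ) ^ (2 * K))⁻¹ * (aInf a L)⁻¹ ≤ ((L : ℝ) ^ K)⁻¹ * (aInf a L)⁻¹ := by gcongr
      _ = (aInf a L)⁻¹ * ((L : ℝ) ^ K)⁻¹ := mul_comm _ _
  · rw [if_neg hbb, abs_zero, mul_zero]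
    positivity

omit hM in
/-- `S₂^{(∞)}` is symmetric. [cite: King1986, (2.14) p.653] -/
theorem kingS2Lim_symm (M : Fin (d + 1) → ℕ) [∀ μ, NeZero (M μ)] (m2 : ℝ) (b b' : Tor M) : kingS2Lim M m2 b b' = kingS2Lim M m2 b' b := by
  unfold kingS2Lim
  have hre : ∀ q : Tor M, (chi M q (b' - b)).re = (chi M q (b - b')).re := fun q => by
    rw [show b - b' = -(b' - b) by abel, ← chi_neg_left, ← conj_chi, Complex.conj_re]
  simp_rw [hre]

omit hM in
/-- `S₂^{(∞)}` is translation invariant. [cite: King1986, (2.21) p.654] -/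
theorem kingS2Lim_transl (M : Fin (d + 1) → ℕ) [∀ μ, NeZero (M μ)] (m2 : ℝ) (b b' v : Tor M) :
    kingS2Lim M m2 (b + v) (b' + v) = kingS2Lim M m2 b b' := by
  unfold kingS2Lim
  rw [add_sub_add_right_eq_sub]

/-- ★★ **THE VOLUME-FREE BOUND**: `|S₂^{(∞)}(b,b′)| ≤ m⁻²` on every unit torus (sharp ceiling `S_∞ ≤ m⁻²`, `|Re e^{iθ}| ≤ 1`). [cite: King1986, Thm 2.1 (2.23) p.654, (4.8) p.671] -/
theorem abs_kingS2Lim_le (hLodd : Odd L) (hL : 2 ≤ L) {m2 : ℝ} (hm : 0 < m2) (b b' : Tor M) : |kingS2Lim M m2 b b'| ≤ m2⁻¹ :=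
  abs_fourierKernel_le M (fun _ => aliasSeries0_nonneg hm.le _) (fun q => aliasSeries0_sOf_le_inv_mass L M hLodd hL hm q) _

/-- ★★ **EXPONENTIAL DECAY OFF THE DIAGONAL** (Thm 3.3 (3.6)'s shape for the continuum kernel, part Ϡ-j): for `b ≠ b′`,
`|S₂^{(∞)}(b,b′)| ≤ (2∕γ_m)·e^{−κ_M|b−b′|_T}` (every auxiliary `a > 0`). [cite: King1986, Thm 3.3 (3.6) p.655, Lemma 4.5 (4.38) p.675] -/
theorem abs_kingS2Lim_le_decay (hLodd : Odd L) (hL : 2 ≤ L) {a m2 : ℝ} (ha : 0 < a) (hm : 0 < m2) {b b' : Tor M} (hbb : b ≠ b') :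
    |kingS2Lim M m2 b b'| ≤ 2 / gamM a m2 L * Real.exp (-(kapM (d + 1) a m2 L * tdistT M b b')) := by
  rw [kingS2Lim_eq_blockCovLim_sub L M a m2, if_neg hbb, mul_zero, sub_zero]
  exact abs_blockCovLim_le_decay L M hLodd hL ha hm b b'

/-- `Σ_{b,b′} J(b)S₂^{(∞)}(b,b′)J(b′) = |Ω|⁻¹Σ_q S_∞(p′(q))|J̃(q)|²` (the continuum form minus the noise floor). [cite: King1986, (2.14) p.653, (4.35) p.674] -/
theorem kingS2Lim_form_eq (hLodd : Odd L) (hL : 2 ≤ L) {a m2 : ℝ} (ha : 0 < a) (hm : 0 < m2) (J : Tor M → ℝ) :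
    ∑ b, ∑ b', J b * kingS2Lim M m2 b b' * J b'
      = (Fintype.card (Tor M) : ℝ)⁻¹ * ∑ q : Tor M, aliasSeries0 m2 (sOf M q) * ‖ft M J q‖ ^ 2 := by
  have hform := blockCovLim_form L M hLodd hL ha hm J
  have hexp : J ⬝ᵥ ((Matrix.of fun b b' => blockCovLim L M a m2 b b') *ᵥ J)
      = ∑ b, ∑ b', J b * blockCovLim L M a m2 b b' * J b' := by
    simp only [dotProduct, Matrix.mulVec, Matrix.of_apply, Finset.mul_sum]
    refine Finset.sum_congr rfl fun b _ => Finset.sum_congr rfl fun b' _ => ?_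
    ring
  have hnoise : ∑ b, ∑ b', J b * ((aInf a L)⁻¹ * (if b = b' then 1 else 0)) * J b' = (aInf a L)⁻¹ * (J ⬝ᵥ J) := by
    simp only [mul_ite, mul_one, mul_zero, ite_mul, zero_mul, Finset.sum_ite_eq, Finset.mem_univ, if_true, dotProduct, Finset.mul_sum]
    refine Finset.sum_congr rfl fun b _ => ?_
    ring
  simp_rw [kingS2Lim_eq_blockCovLim_sub L M a m2, mul_sub, sub_mul, Finset.sum_sub_distrib]
  rw [← hexp, hform, hnoise]
  ring

/-- ★ `0 ≤ Σ JS₂^{(∞)}J` — the limit kernel is positive semi-definite. [cite: King1986, (2.14) p.653] -/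
theorem kingS2Lim_form_nonneg (hLodd : Odd L) (hL : 2 ≤ L) {m2 : ℝ} (hm : 0 < m2) (J : Tor M → ℝ) : 0 ≤ ∑ b, ∑ b', J b * kingS2Lim M m2 b b' * J b' := by
  rw [kingS2Lim_form_eq L M hLodd hL one_pos hm J]
  exact fourierSum_aliasSeries0_nonneg M hm J

/-- `Σ JS₂^{(∞)}J ≤ m⁻²⟨J, J⟩`. [cite: King1986, (2.14) p.653, (4.8) p.671] -/
theorem kingS2Lim_form_le (hLodd : Odd L) (hL : 2 ≤ L) {m2 : ℝ} (hm : 0 < m2) (J : Tor M → ℝ) :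
    ∑ b, ∑ b', J b * kingS2Lim M m2 b b' * J b' ≤ m2⁻¹ * (J ⬝ᵥ J) := by
  rw [kingS2Lim_form_eq L M hLodd hL one_pos hm J]
  exact fourierSum_aliasSeries0_le L M hLodd hL hm J

end Limit

/-! ## §3 On the tori (2.21): Theorem 2.1's statement for the block-smeared two-point function -/

section Torus

variable (L : ℕ) [NeZero L] (m2 : ℝ)

/-- The free two-point functions on the tori (2.21): `S₂^{ε_K}(T; b, b′)` on the unit lattice `Ω_T`. [cite: King1986, Thm 2.1 (2.22) p.654, (2.14) p.653] -/
def kingFreeS2 (T : Torus221 (d + 1)) (K : ℕ) (b b' : Tor (t221Sites T)) : ℝ :=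
  haveI := t221Sites_neZero T
  kingS2 (L ^ K) (t221Sites T) m2 b b'

/-- ★★★ **THEOREM 2.1 FOR THE BLOCK-SMEARED TWO-POINT FUNCTION OF THE FREE FIELD**: on EVERY torus (2.21), for odd `L ≥ 2`, `m² > 0`: the limit
`S₂(T; b, b′) = lim_K S₂^{ε_K}(T; b, b′)` exists, is bounded by `m⁻²` INDEPENDENTLY OF `|T|` and of the sites, is a positive semi-definite kernel, and is approached at the
(4.38)-shape rate `C′e^{−δ|b−b′|_T}ε_K` with ONE pair `(C′, δ)` for all tori and all `K ≥ 1`. [cite: King1986, Thm 2.1 (2.22)–(2.23) p.654, Lemma 4.5 (4.38) p.675] -/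
theorem kingFreeS2_continuumLimit (hLodd : Odd L) (hL : 2 ≤ L) (hm : 0 < m2) :
    ∃ C' δ : ℝ, 0 < C' ∧ 0 < δ ∧ ∀ T : Torus221 (d + 1),
      haveI := t221Sites_neZero T
      ∀ b b' : Tor (t221Sites T),
        Tendsto (fun K : ℕ => kingFreeS2 L m2 T K b b') atTop (𝓝 (kingS2Lim (t221Sites T) m2 b b'))
        ∧ |kingS2Lim (t221Sites T) m2 b b'| ≤ m2⁻¹
        ∧ (∀ J : Tor (t221Sites T) → ℝ, 0 ≤ ∑ c, ∑ c', J c * kingS2Lim (t221Sites T) m2 c c' * J c')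
        ∧ ∀ K : ℕ, 1 ≤ K → |kingFreeS2 L m2 T K b b' - kingS2Lim (t221Sites T) m2 b b'|
            ≤ C' * Real.exp (-(δ * tdistT (t221Sites T) b b')) * eps L K := by
  have hL1 : (1 : ℝ) < L := by exact_mod_cast (show 1 < L by omega)
  have haI := aInf_pos one_pos hL1
  have hkap : 0 < kapM (d + 1) 1 m2 L := (kapM_pos_le (d := d + 1) one_pos hm hL).1
  have hCd : 0 ≤ CdiffM (d + 1) 1 m2 L := CdiffM_nonneg (d := d + 1) one_pos hm hL
  refine ⟨2 * CdiffM (d + 1) 1 m2 L + (aInf 1 L)⁻¹, kapM (d + 1) 1 m2 L / 2, by positivity, by positivity, fun T => ?_⟩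
  haveI := t221Sites_neZero T
  intro b b'
  have hNZ : (⟨by omega⟩ : NeZero L) = ‹NeZero L› := Subsingleton.elim _ _
  refine ⟨?_, abs_kingS2Lim_le L (t221Sites T) hLodd hL hm b b', fun J => kingS2Lim_form_nonneg L (t221Sites T) hLodd hL hm J, fun K hK => ?_⟩
  · have h := tendsto_kingS2 L (t221Sites T) hLodd hL hm b b'
    exact h
  · have h := abs_kingS2_sub_lim_le L (t221Sites T) hLodd hL one_pos hm hK b b'
    rw [eps]
    exact h

end Torus

end Summit.QuantumFields.YangMills.BalabanUVNodes.N15KingModelRung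

end
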